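import Summits.ResolutionOfSingularities.ResolutionOfSingularities.Theses.Valuative
import Literature.AlgebraicGeometry.Morphisms.NagataCompactification
import Literature.AlgebraicGeometry.Limits.PushoutOpenImmersion
import Mathlib.RingTheory.Jacobson.Ring
import Mathlib.RingTheory.Algebraic.Basic
import Mathlib.AlgebraicGeometry.Morphisms.Separated
import Mathlib.AlgebraicGeometry.Morphisms.Proper

/-!
# Negative lemmas for crux `PatchingRel` (stmt-ResolutionOfSingularities-0642), line
# `sandwiched-gluing`, stub `stub_nagataCompactification`: the morphism hypotheses of the named
# fact `NagataCompactification` are load-bearing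

The line's stub S6 is the named fact `Literature.AlgebraicGeometry.Morphisms.NagataCompactification`
(Conrad 2007, Thm. 4.1: a SEPARATED morphism OF FINITE TYPE to a qcqs scheme factors as an open
immersion followed by a proper morphism). Hypothesis mutation (drefute gen 3): each of the two
morphism hypotheses is necessary — the statement with it dropped is FALSE, by an explicit witness:

* `not_nagata_without_finiteType` — drop `LocallyOfFiniteType f`: `Spec 𝔽₂(t) → Spec 𝔽₂` has no
  compactification, since an open subscheme of a proper (hence finite-type) `k`-scheme is of finite
  type over `k`, and `k(t)` is not a finitely generated `k`-algebra (Zariski's lemma,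
  `finite_of_finite_type_of_isJacobsonRing`, plus transcendence of `t`).
* `not_nagata_without_isSeparated` — drop `IsSeparated f`: the affine line with doubled origin
  `𝔸¹ ⨿_{D(t)} 𝔸¹ → Spec 𝔽₂` (Mathlib's pushout of the open immersion `D(t) ↪ 𝔸¹` with itself) is
  quasi-compact and of finite type but admits no open immersion into a proper `𝔽₂`-scheme, because
  it is not separated: `not_isSeparated_pushoutDesc_self` — doubling an integral scheme along a
  non-empty proper open `U` is never separated over any base (the two charts agree on the dense
  `U`, so by `ext_of_isDominant_of_isSeparated` they would coincide, yet a point outside `U` has two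
  distinct images, `Literature.AlgebraicGeometry.Limits.exists_eq_of_inl_eq_inr`).

(Any ground field works; `𝔽₂` avoids instance bookkeeping.) The remaining hypotheses —
`QuasiCompact f` (witness `∐_ℕ Spec k`) and the qcqs base — are load-bearing on paper only.
-/

open CategoryTheory CategoryTheory.Limits AlgebraicGeometry
open Literature.AlgebraicGeometry.Limits

set_option linter.dupNamespace false

namespace Summit.ResolutionOfSingularities.ResolutionOfSingularities.Theorems.PatchingRel.Negative

universe u

/-- **Nagata compactification needs finite type**: the statement of `NagataCompactification`
with `LocallyOfFiniteType f` dropped is false — witness `Spec 𝔽₂(t) → Spec 𝔽₂`. [folklore] -/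
theorem not_nagata_without_finiteType :
    ¬ ∀ (X S : Scheme.{0}) (f : X ⟶ S) [CompactSpace S] [QuasiSeparatedSpace S]
        [IsSeparated f] [QuasiCompact f],
        ∃ (Xc : Scheme.{0}) (j : X ⟶ Xc) (g : Xc ⟶ S),
          IsOpenImmersion j ∧ IsProper g ∧ j ≫ g = f := by
  intro h
  let k : Type := ZMod 2
  let K : Type := FractionRing (Polynomial k)
  let φ : CommRingCat.of k ⟶ CommRingCat.of K := CommRingCat.ofHom (algebraMap k K)
  obtain ⟨Xc, j, g, hj, hg, hfac⟩ := h (Spec (.of K)) (Spec (.of k)) (Spec.map φ)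
  have h1 : LocallyOfFiniteType (Spec.map φ) := by rw [← hfac]; infer_instance
  have h2 := (HasRingHomProperty.Spec_iff (P := @LocallyOfFiniteType)).mp h1
  haveI : Algebra.FiniteType k K := RingHom.finiteType_algebraMap.mp h2
  haveI : Module.Finite k K := finite_of_finite_type_of_isJacobsonRing k K
  have hT : Transcendental k (algebraMap (Polynomial k) K Polynomial.X) :=
    (transcendental_algebraMap_iff (IsFractionRing.injective (Polynomial k) K)).mpr
      (Polynomial.transcendental_X k)
  exact hT (Algebra.IsAlgebraic.isAlgebraic _)

/-- **Doubling a scheme along a dense proper open is not separated**: for `Z` integral,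
`U ⊊ Z` a non-empty open and any `q : Z → S`, the structure map `Z ⨿_U Z → S` of the pushout of
`U ↪ Z` with itself (Mathlib's pushout of schemes along open immersions) is not separated.
[folklore] -/
theorem not_isSeparated_pushoutDesc_self {Z S : Scheme.{u}} [IsIntegral Z] (U : Z.Opens)
    (hU : (U : Set Z).Nonempty) (hU' : (U : Set Z) ≠ Set.univ) (q : Z ⟶ S) :
    ¬ IsSeparated (pushout.desc (f := U.ι) (g := U.ι) q q rfl) := by
  intro hsep
  haveI : IsDominant U.ι := ⟨by
    rw [DenseRange, Scheme.Opens.range_ι]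
    exact U.2.dense hU⟩
  have heq : pushout.inl U.ι U.ι = pushout.inr U.ι U.ι :=
    ext_of_isDominant_of_isSeparated (pushout.desc q q rfl)
      (by rw [pushout.inl_desc, pushout.inr_desc]) U.ι pushout.condition
  obtain ⟨z, hz⟩ : ∃ z : Z, z ∉ (U : Set Z) :=
    not_forall.mp fun hcon => hU' (Set.eq_univ_of_forall hcon)
  obtain ⟨w, hw, -⟩ := exists_eq_of_inl_eq_inr U.ι U.ι z z (by rw [heq])
  apply hz
  rw [← hw, Scheme.Opens.ι_apply]
  exact w.2

/-- **Nagata compactification needs separatedness**: the statement of `NagataCompactification`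
with `IsSeparated f` dropped is false — witness the affine line with doubled origin
`𝔸¹ ⨿_{D(t)} 𝔸¹ → Spec 𝔽₂` (quasi-compact, of finite type, not separated). [folklore] -/
theorem not_nagata_without_isSeparated :
    ¬ ∀ (X S : Scheme.{0}) (f : X ⟶ S) [CompactSpace S] [QuasiSeparatedSpace S]
        [LocallyOfFiniteType f] [QuasiCompact f],
        ∃ (Xc : Scheme.{0}) (j : X ⟶ Xc) (g : Xc ⟶ S),
          IsOpenImmersion j ∧ IsProper g ∧ j ≫ g = f := by
  intro h
  let k : Type := ZMod 2
  let A : Scheme.{0} := Spec (CommRingCat.of (Polynomial k))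
  -- the origin-complement `D(t) ⊆ 𝔸¹`
  let U : A.Opens := PrimeSpectrum.basicOpen (R := Polynomial k) Polynomial.X
  have hmem : ∀ x : A, x ∈ U ↔ (Polynomial.X : Polynomial k) ∉ x.asIdeal := fun x =>
    PrimeSpectrum.mem_basicOpen (R := Polynomial k) Polynomial.X x
  have hU : (U : Set A).Nonempty := by
    let x : A := (⟨⊥, Ideal.isPrime_bot⟩ : PrimeSpectrum (Polynomial k))
    refine ⟨x, (hmem x).mpr ?_⟩
    change (Polynomial.X : Polynomial k) ∉ (⊥ : Ideal (Polynomial k))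
    rw [Ideal.mem_bot]
    exact Polynomial.X_ne_zero
  have hU' : (U : Set A) ≠ Set.univ := by
    intro hA
    have hp : (Ideal.span {(Polynomial.X : Polynomial k)}).IsPrime :=
      (Ideal.span_singleton_prime Polynomial.X_ne_zero).mpr Polynomial.prime_X
    let x : A := (⟨Ideal.span {(Polynomial.X : Polynomial k)}, hp⟩ : PrimeSpectrum (Polynomial k))
    have hx : x ∈ (U : Set A) := by rw [hA]; trivial
    exact ((hmem x).mp hx) (Ideal.mem_span_singleton_self _)
  -- the doubled line and its structure map
  let q : A ⟶ Spec (CommRingCat.of k) := Spec.map (CommRingCat.ofHom (algebraMap k (Polynomial k)))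
  let f : pushout U.ι U.ι ⟶ Spec (CommRingCat.of k) := pushout.desc q q rfl
  haveI : LocallyOfFiniteType q := by
    rw [HasRingHomProperty.Spec_iff (P := @LocallyOfFiniteType)]
    exact RingHom.finiteType_algebraMap.mpr inferInstance
  haveI : LocallyOfFiniteType f := locallyOfFiniteType_pushoutDesc U.ι U.ι q q rfl
  haveI : QuasiCompact f := quasiCompact_pushoutDesc U.ι U.ι q q rfl
  obtain ⟨Xc, j, g, hj, hg, hfac⟩ := h (pushout U.ι U.ι) (Spec (.of k)) f
  have hsep : IsSeparated f := by rw [← hfac]; infer_instance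
  exact not_isSeparated_pushoutDesc_self U hU hU' q hsep

end Summit.ResolutionOfSingularities.ResolutionOfSingularities.Theorems.PatchingRel.Negative
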